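import Literature.AnabelianGeometry.SemiGraphs.SpecialFibreTowerOfCoveringsVertexFibres
import HarnessLib

/-!
# [SemiAnbd] Example 3.10: the fibres `𝒢_i` of the special-fibre tower over `π₁^temp(𝒢)` of a FINITE `𝒢` have
# finitely many vertices

Mochizuki, *Semi-graphs of anabelioids*, Publ. RIMS **42** (2006), §3, Example 3.10, manuscript p. 44
[cite: MochizukiSemiAnbd2006, Ex 3.10 p.44] (the `𝒢_i` are the dual semi-graphs of the special fibres of FINITE
étale coverings — finite semi-graphs); Remark 2.2.1 p. 24.

PROOF-ONLY corollary (abc-iut cell, layer L3, seat abc-iut-L3-t2 gen 5, row «Ex310-VERTEX-FIBRES») of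
`SpecialFibreTower.exists_of_coverings_vertexFibres`: by the vertex dictionary (V1)/(V3)/(V4) the vertices of `𝔾_i`
over a vertex `v` of `𝔾` INJECT into `π₁^temp(𝒢)/N_i` (choose `K₀` verticial at `v`; a vertex `x` over `v` carries the
trace of some `g_x K₀ g_x⁻¹`, and `g_x N_i` determines `x`), so for FINITE `𝒢` every fibre `𝒢_i` of the tower has
finitely many vertices (`N_i` has finite index) — the vertex half of the field `FiniteLevels.finite_vertex` of the
origin record `SpecialFibreTower.PiData` at the genuine fibres.  No definition; nothing about curves; no side is taken
on [IUTchIII] Cor. 3.12.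
-/

noncomputable section

open CategoryTheory Topology

namespace Literature.AnabelianGeometry.SemiGraphs

open Literature.AlgebraicGeometry.Frobenioids (IsConnectedObj)
open ProfiniteSemiGraph

universe u

/-- `(g n) K (g n)⁻¹ = (g n g⁻¹) (g K g⁻¹) (g n g⁻¹)⁻¹`. [folklore] -/
private theorem map_conj_mul_swap {G : Type u} [Group G] (K : Subgroup G) (g n : G) :
    K.map (MulAut.conj (g * n)).toMonoidHom =
      (K.map (MulAut.conj g).toMonoidHom).map (MulAut.conj (g * n * g⁻¹)).toMonoidHom := by
  rw [Subgroup.map_map]; congr 1; ext x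
  simp only [MonoidHom.coe_comp, MulEquiv.coe_toMonoidHom, Function.comp_apply, MulAut.conj_apply]; group

namespace SpecialFibreTower

variable {𝒢 : ProfiniteSemiGraph.{u}}

/-- **The fibres of the Ex. 3.10 tower over `π₁^temp(𝒢)` of a FINITE coherent Thm-3.7 semi-graph of anabelioids have
finitely many vertices**: the tower of `exists_of_coverings_vertexFibres` (levels `N`, fibres `𝒢_{S_i}`, admissible
kernels `1`) with, for every `i`, `Finite (vertices of 𝔾_i)` — the vertices over `v` inject into `π₁^temp(𝒢)/N_i`.
[cite: MochizukiSemiAnbd2006, Ex 3.10 p.44] -/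
theorem exists_of_coverings_finite_vertex [Finite 𝒢.graph.Vertex] [Finite 𝒢.graph.Edge]
    (h37 : 𝒢.Thm37Hypotheses) (hcoh : 𝒢.IsCoherent) (c : TemperedPiChart 𝒢) (N : ℕ → Subgroup c.G)
    (hanti : Antitone N) (hopen : ∀ i, IsOpen (N i : Set c.G))
    (hchar : ∀ (i) (φ : c.G ≃ₜ* c.G), (N i).map φ.toMulEquiv.toMonoidHom = N i)
    (hnormal : ∀ i, (N i).Normal) (hfi : ∀ i, (N i).FiniteIndex) (hexh : ∀ g : c.G, (∀ i, g ∈ N i) → g = 1) :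
    ∃ T : SpecialFibreTower c.G, T.N = N ∧ (∀ i, T.admKer i = ⊥) ∧
      ∀ i, (∃ (S : CovObj 𝒢) (hS : S.IsTempered), T.Gc i = S.coveringGraph ∧
        IsConnectedObj (⟨S, hS⟩ : BTempCat 𝒢)) ∧ Finite (T.Gc i).graph.Vertex := by
  classical
  obtain ⟨T, hTN, hadm, hfib⟩ := exists_of_coverings_vertexFibres h37
    (isStrictlyCoherent_of_finite ⟨‹_›, ‹_›⟩ hcoh) c N hanti hopen hchar hnormal hfi hexh
  refine ⟨T, hTN, hadm, fun i => ?_⟩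
  obtain ⟨S, hS, hGc, proj, hSc, -, hV1, -, hV3, hV4, -, -⟩ := hfib i
  refine ⟨⟨S, hS, hGc, hSc⟩, ?_⟩
  subst hTN
  haveI : Finite (c.G ⧸ T.N i) := by
    haveI := hfi i
    exact Subgroup.finite_quotient_of_finiteIndex
  have h36 := h37.toProp36Hypotheses
  -- a reference verticial subgroup `K₀ v` at every vertex of `𝒢`
  have hK₀ : ∀ v : 𝒢.graph.Vertex, ∃ K₀ : Subgroup c.G, K₀ ∈ verticialSubgroups c v := fun v =>
    verticialSubgroups_nonempty h36.isQuasiCoherent h36.isGaloisCountable c v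
  choose K₀ hK₀ using hK₀
  -- every vertex `x` of `𝔾_i` carries the trace of some conjugate `g_x K₀ g_x⁻¹`
  have hg : ∀ x : (T.Gc i).graph.Vertex, ∃ g : c.G,
      (((K₀ (proj x)).map (MulAut.conj g).toMonoidHom).subgroupOf (T.N i)).map (T.adm i).toMonoidHom ∈
        verticialSubgroups (T.chart i) x := fun x => by
    obtain ⟨K, hK, hKx⟩ := hV1 x
    obtain ⟨g, rfl⟩ := exists_conj_of_mem_verticialSubgroups c (hK₀ (proj x)) hK
    exact ⟨g, hKx⟩
  choose g hg using hg
  -- `x ↦ (proj x, g_x N_i)` is injective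
  refine Finite.of_injective (fun x => (⟨proj x, (QuotientGroup.mk (g x) : c.G ⧸ T.N i)⟩ :
    𝒢.graph.Vertex × (c.G ⧸ T.N i))) fun x y hxy => ?_
  simp only [Prod.mk.injEq] at hxy
  obtain ⟨hpxy, hgxy⟩ := hxy
  rw [QuotientGroup.eq] at hgxy
  -- `g_y = g_x n` with `n ∈ N_i`, so the trace of `g_y K₀ g_y⁻¹` is verticial at `x` as well
  set n : c.G := (g x)⁻¹ * g y with hndef
  have hgy : g y = g x * n := by rw [hndef, mul_inv_cancel_left]
  have hKx : ((K₀ (proj x)).map (MulAut.conj (g x)).toMonoidHom) ∈ verticialSubgroups c (proj x) :=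
    conj_mem_verticialSubgroups c (hK₀ (proj x)) (g x)
  have hKy' : ((K₀ (proj x)).map (MulAut.conj (g y)).toMonoidHom) ∈ verticialSubgroups c (proj x) :=
    conj_mem_verticialSubgroups c (hK₀ (proj x)) (g y)
  have hy' := hg y
  rw [← hpxy] at hy'
  -- the trace of `g_y K₀ g_y⁻¹ = (g_x n g_x⁻¹)(g_x K₀ g_x⁻¹)(…)⁻¹` is verticial at `x`
  have hx' : (((K₀ (proj x)).map (MulAut.conj (g y)).toMonoidHom).subgroupOf (T.N i)).map (T.adm i).toMonoidHom ∈
      verticialSubgroups (T.chart i) x := by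
    refine ((hV4 (proj x) x _ _ hKx hKy' (hg x)).2 ⟨g x * n * (g x)⁻¹, (hnormal i).conj_mem n hgxy (g x), ?_⟩)
    rw [hgy]; exact map_conj_mul_swap _ _ _
  -- uniqueness of the vertex carrying a given trace
  obtain ⟨z, -, hz⟩ := (hV3 (proj x) _ hKy').1
  exact (hz x hx').trans (hz y hy').symm

end SpecialFibreTower

end Literature.AnabelianGeometry.SemiGraphs

end
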